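import Literature.AlgebraicGeometry.Resolution.BlowupChartRsop
import Mathlib.RingTheory.Flat.FaithfullyFlat.Algebra
import Mathlib.RingTheory.TensorProduct.Quotient
import Mathlib.RingTheory.RegularLocalRing.Polynomial
import Mathlib.RingTheory.Flat.TorsionFree
import Mathlib.RingTheory.RingHom.Flat
import HarnessLib

/-!
# [OURS · L1 W4.5(b) · EL♮(3)] THE EXCEPTIONAL CHART MODULO THE EXCEPTIONAL DIVISOR IS A FLAT LOCAL `(R ⧸ I)`-ALGEBRA
# (algebra layer of the (N3)/(N3′) dischargers of TOWER₄'s S6 `hCech`: nonzerodivisors ASCEND, reducedness DESCENDS, regularity ASCENDS)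

Crux chain w45b (cell `res-hironaka`, slot W4.5(b)), working crux **EL♮** = stmt-ResolutionOfSingularities-20038, child **EL♮(3)** =
stmt-ResolutionOfSingularities-20148, route EquisingularLift, line `sections`; registered stub `stub_elnat_coneTowerPointResolution` @ `ReachTower₄`,
stand-in S6 `hCech`, named sub-stand-ins (N3) `hShadow` / (N3′) `hShadowOld` of res-D-pv-057's `Tower.hCech_of₃` (…NatTowerCechRoundCloserV3).
Written by res-L1-w45b-stub-2 g8 (res-L1-w45b-lead-2's (γ) word STATUS 2026-08-27T21:14:43Z: «(N3)/(N3′) TRUE as worded; supplier stub-2»).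
HONEST FRAMING: OURS; NOT a statement of any manuscript; AI-written, weaker than expert review. No `sorry`; standard axioms; DEF-FREE.
`--supports stmt-ResolutionOfSingularities-20148 --as helper`.

WHAT (pure commutative algebra, abstract chart data as in Literature …Resolution.BlowupChartRsop §AbstractChart): a ring map `ψ : R → A`, elements
`c : Fin n → R` with `I = (c)`, a ring isomorphism `ε : (R ⧸ I)[T_j : j ≠ i] ≅ A ⧸ (ψ cᵢ)` with `ε(r̄) = ψ r` (Stacks 0BIQ for a quasi-regular `c` in the
blow-up algebra `A = R[I/cᵢ]`), a prime `𝔓 ⊂ A`, and `L` ANY localisation of `A` at `𝔓` (in the application: `R = 𝒪_{X,x}`, `L = 𝒪_{X₂,y₂}` a stalk of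
the blow-up through the stalk dictionary …W45bBlowupStalkDictionary). Writing `K_L = (ψ cᵢ)·L` (the stalk of the exceptional divisor) and, for an ideal
`𝔞 ⊇ I` of `R`, `θ_𝔞 : R ⧸ 𝔞 → L ⧸ (K_L + 𝔞 L)` for the induced map:
* `mul_mem_span_singleton_swap` — the elementary swap «`j` a nonzerodivisor and `i` a nonzerodivisor mod `j` ⟹ `j` a nonzerodivisor mod `i`»;
* `iSup_colon_pow_le_of_forall_mul_mem` — SATURATION IS TRIVIAL when the exceptional equation is a nonzerodivisor modulo the ideal:
  `⋃ₙ (L' : (w)ⁿ) = L'` (this is «total transform = strict transform»);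
* `map_centre_le_span` — `ψ(I) ⊆ (ψ cᵢ)`;
* **`flat_quotientMap_centre`** — `θ_I : R ⧸ I → L ⧸ K_L` is FLAT (`L ⧸ K_L` is a localisation of `A ⧸ (ψ cᵢ) ≅ (R ⧸ I)[T]`, a free `R ⧸ I`-module);
* **`flat_quotientMap_of_le`** — `θ_𝔞` is flat for every `𝔞 ⊇ I` (base change);
* **`mem_sup_of_mul_mem_sup`** — NONZERODIVISORS ASCEND: if `r` is a nonzerodivisor modulo `𝔞` then `ψ r` is a nonzerodivisor modulo `K_L + 𝔞 L`;
* **`mem_of_map_mem_sup`** / **`isReduced_quotient_of_isReduced`** — when `𝔓` lies over the maximal ideal of the local ring `R`, `θ_𝔞` is faithfully flat, hence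
  injective, so REDUCEDNESS DESCENDS from `L ⧸ (K_L + 𝔞 L)` to `R ⧸ 𝔞`;
* **`isRegularLocalRing_quotient_sup_of_isRegularRing`** — REGULARITY ASCENDS: `R ⧸ 𝔞` a regular ring ⟹ `L ⧸ (K_L + 𝔞 L)` a regular local ring
  (`A ⧸ ((ψ cᵢ) + 𝔞 A) ≅ (R ⧸ 𝔞)[T]` is regular, Mathlib `MvPolynomial.isRegularRing_of_isRegularRing`, and tree `isRegularLocalRing_quot_map_of_isRegularRing`).

References (index only): [cite: StacksProject, Tag 0BIQ] (the chart of a quasi-regular blow-up modulo the exceptional divisor); [cite: Matsumura1987, Thm. 7.5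
and §23] (faithful flatness of flat local maps; regularity of polynomial / localised rings); tree: Literature …Resolution.BlowupChartRsop (`flat_quotBar`,
`quotBarAlgebra`, `quotBar_algebraMap_C`, `isRegularLocalRing_quot_map_of_isRegularRing`).
-/

set_option linter.dupNamespace false -- mandated namespace `Summit.<Summit>.<Problem>` of this single-conjunct summit

noncomputable section

open IsLocalRing Literature.AlgebraicGeometry.Resolution

namespace Summit.ResolutionOfSingularities.ResolutionOfSingularities.Cruxes.EquisingularLiftNat.Sections.CechShadow

universe u

/-! ## Elementary: the swap of a regular pair and trivial saturation -/

/-- **Swap of a regular pair (the cheap direction).** If `j` is a nonzerodivisor of `S` and `i` is a nonzerodivisor modulo `j`, then `j` is a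
nonzerodivisor modulo `i`. [cite: Matsumura1987, §16] -/
theorem mul_mem_span_singleton_swap {S : Type u} [CommRing S] {i j : S} (hj : ∀ b : S, j * b = 0 → b = 0)
    (hij : ∀ a : S, i * a ∈ Ideal.span {j} → a ∈ Ideal.span {j}) (b : S) (hb : j * b ∈ Ideal.span {i}) :
    b ∈ Ideal.span {i} := by
  obtain ⟨a, ha⟩ := Ideal.mem_span_singleton'.mp hb
  have h1 : i * a ∈ Ideal.span {j} := Ideal.mem_span_singleton'.mpr ⟨b, by rw [mul_comm i a, ha, mul_comm]⟩
  obtain ⟨a', ha'⟩ := Ideal.mem_span_singleton'.mp (hij a h1)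
  have h2 : j * (b - a' * i) = 0 := by
    rw [mul_sub, ← ha, ← ha']
    ring
  have h3 : b = a' * i := sub_eq_zero.mp (hj _ h2)
  exact Ideal.mem_span_singleton'.mpr ⟨a', h3.symm⟩

/-- If `w` is a nonzerodivisor modulo `L'`, so is every power of `w`. [folklore] -/
theorem mem_of_pow_mul_mem {S : Type u} [CommRing S] (L' : Ideal S) (w : S) (hw : ∀ z : S, w * z ∈ L' → z ∈ L')
    (m : ℕ) (z : S) (hz : w ^ m * z ∈ L') : z ∈ L' := by
  induction m generalizing z with
  | zero => simpa using hz
  | succ m ih =>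
    rw [pow_succ, mul_assoc] at hz
    exact hw z (ih _ hz)

/-- **Trivial saturation.** If the exceptional equation `w` is a nonzerodivisor modulo the ideal `L'` (and `E = (w)`), then
`⋃ₙ (L' : Eⁿ) ⊆ L'` — «the total transform is already the strict transform». [cite: StacksProject, Tag 080E] -/
theorem iSup_colon_pow_le_of_forall_mul_mem {S : Type u} [CommRing S] (L' E : Ideal S) (w : S) (hE : E = Ideal.span {w})
    (hw : ∀ z : S, w * z ∈ L' → z ∈ L') :
    (⨆ m : ℕ, Submodule.colon L' ((E ^ m : Ideal S) : Set S)) ≤ L' := by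
  refine iSup_le fun m x hx => ?_
  rw [Submodule.mem_colon] at hx
  have h1 : x • w ^ m ∈ L' := hx (w ^ m) (by rw [hE, Ideal.span_singleton_pow]; exact Ideal.mem_span_singleton_self _)
  rw [smul_eq_mul, mul_comm] at h1
  exact mem_of_pow_mul_mem L' w hw m x h1

/-- The same as an equality when `L'` is contained in the union (e.g. the `m = 0` term). [folklore] -/
theorem iSup_colon_pow_eq_of_forall_mul_mem {S : Type u} [CommRing S] (L' E : Ideal S) (w : S) (hE : E = Ideal.span {w})
    (hw : ∀ z : S, w * z ∈ L' → z ∈ L') :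
    (⨆ m : ℕ, Submodule.colon L' ((E ^ m : Ideal S) : Set S)) = L' := by
  refine le_antisymm (iSup_colon_pow_le_of_forall_mul_mem L' E w hE hw) ?_
  refine le_iSup_of_le (f := fun m : ℕ => Submodule.colon L' ((E ^ m : Ideal S) : Set S)) 0 ?_
  intro x hx
  rw [Submodule.mem_colon]
  intro s _
  rw [smul_eq_mul]
  exact L'.mul_mem_right _ hx

/-! ## The abstract chart modulo the exceptional divisor -/

section AbstractChart

variable {R : Type u} [CommRing R] {n : ℕ} (c : Fin n → R) (i : Fin n)
  {A : Type u} [CommRing A] (ψ : R →+* A)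
  (ε : MvPolynomial {j : Fin n // j ≠ i} (R ⧸ Ideal.span (Set.range c)) ≃+* A ⧸ Ideal.span {ψ (c i)})
  (hεC : ∀ r : R, ε (MvPolynomial.C (Ideal.Quotient.mk (Ideal.span (Set.range c)) r)) =
    Ideal.Quotient.mk _ (ψ r))
  (𝔓 : Ideal A) [𝔓.IsPrime] (L : Type u) [CommRing L] [Algebra A L] [IsLocalization.AtPrime L 𝔓]

local notation3 "I" => Ideal.span (Set.range c)
local notation3 "P" => MvPolynomial {j : Fin n // j ≠ i} (R ⧸ I)
local notation3 "KA" => Ideal.span {ψ (c i)}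
local notation3 "KL" => Ideal.map (algebraMap A L) (Ideal.span {ψ (c i)})
local notation3 "φL" => (algebraMap A L).comp ψ

include hεC in
omit [𝔓.IsPrime] in
/-- `ψ(I) ⊆ (ψ cᵢ)`: through `ε`, the class of `ψ c_k` is `ε(c̄_k) = ε(0) = 0`. [cite: StacksProject, Tag 0BIQ] -/
theorem map_centre_le_span : (I).map ψ ≤ KA := by
  rw [Ideal.map_span, Ideal.span_le]
  rintro _ ⟨_, ⟨k, rfl⟩, rfl⟩
  have h := hεC (c k)
  rw [(Ideal.Quotient.eq_zero_iff_mem).mpr (Ideal.subset_span (Set.mem_range_self k)), MvPolynomial.C_0, map_zero] at h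
  exact Ideal.Quotient.eq_zero_iff_mem.mp h.symm

omit [𝔓.IsPrime] in
/-- For `𝔞 ⊇ I`: `𝔞 ⊆ φ_L⁻¹(K_L + 𝔞 L)`, so `θ_𝔞 : R ⧸ 𝔞 → L ⧸ (K_L + 𝔞 L)` is defined. [folklore] -/
theorem le_comap_sup_map (𝔞 : Ideal R) : 𝔞 ≤ (KL ⊔ 𝔞.map φL).comap φL :=
  Ideal.le_comap_map.trans (Ideal.comap_mono le_sup_right)

include hεC in
omit [𝔓.IsPrime] in
/-- In particular for `𝔞 = I` the target is `L ⧸ K_L` itself: `I ⊆ φ_L⁻¹(K_L)`. [folklore] -/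
theorem centre_le_comap : I ≤ (KL).comap φL := by
  intro r hr
  rw [Ideal.mem_comap, RingHom.comp_apply]
  exact Ideal.mem_map_of_mem _ (map_centre_le_span c i ψ ε hεC (Ideal.mem_map_of_mem ψ hr))

include hεC 𝔓 in
/-- **`θ_I : R ⧸ I → L ⧸ K_L` is flat**: it factors as `R ⧸ I → (R ⧸ I)[T] ≅ A ⧸ (ψ cᵢ) → L ⧸ K_L`, a free extension followed by a localisation
(tree `flat_quotBar`). [cite: StacksProject, Tag 0BIQ] -/
theorem flat_quotientMap_centre : (Ideal.quotientMap KL φL (centre_le_comap c i ψ ε hεC L)).Flat := by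
  letI algP : Algebra P (L ⧸ KL) := quotBarAlgebra c i L ψ ε
  haveI hflatP : Module.Flat P (L ⧸ KL) := flat_quotBar c i L ψ ε 𝔓
  letI algR : Algebra (R ⧸ I) (L ⧸ KL) := (Ideal.quotientMap KL φL (centre_le_comap c i ψ ε hεC L)).toAlgebra
  haveI : IsScalarTower (R ⧸ I) P (L ⧸ KL) := by
    refine IsScalarTower.of_algebraMap_eq fun r => ?_
    obtain ⟨r, rfl⟩ := Ideal.Quotient.mk_surjective r
    rw [MvPolynomial.algebraMap_eq, quotBar_algebraMap_C c i L ψ ε hεC, RingHom.algebraMap_toAlgebra, Ideal.quotientMap_mk,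
      RingHom.comp_apply]
  exact Module.Flat.trans (R ⧸ I) P (L ⧸ KL)

include hεC 𝔓 in
/-- **`θ_𝔞 : R ⧸ 𝔞 → L ⧸ (K_L + 𝔞 L)` is flat** for every ideal `𝔞 ⊇ I` (base change of `θ_I` along `R ⧸ I → R ⧸ 𝔞`).
[cite: Matsumura1987, Thm. 7.5] -/
theorem flat_quotientMap_of_le (𝔞 : Ideal R) (h𝔞 : I ≤ 𝔞) :
    (Ideal.quotientMap (KL ⊔ 𝔞.map φL) φL (le_comap_sup_map c i ψ L 𝔞)).Flat := by
  set θ := Ideal.quotientMap KL φL (centre_le_comap c i ψ ε hεC L) with hθ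
  letI algR : Algebra (R ⧸ I) (L ⧸ KL) := θ.toAlgebra
  haveI : Module.Flat (R ⧸ I) (L ⧸ KL) := flat_quotientMap_centre c i ψ ε hεC 𝔓 L
  set J : Ideal (R ⧸ I) := 𝔞.map (Ideal.Quotient.mk I) with hJ
  -- base change to `(R ⧸ I) ⧸ J`
  haveI hbc : Module.Flat ((R ⧸ I) ⧸ J) ((L ⧸ KL) ⧸ J.map (algebraMap (R ⧸ I) (L ⧸ KL))) :=
    Module.Flat.of_linearEquiv (Algebra.TensorProduct.quotIdealMapEquivQuotTensor (L ⧸ KL) J).toLinearEquiv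
  have hflat1 : (algebraMap ((R ⧸ I) ⧸ J) ((L ⧸ KL) ⧸ J.map (algebraMap (R ⧸ I) (L ⧸ KL)))).Flat :=
    RingHom.flat_algebraMap_iff.mpr hbc
  -- the two identifications `(R ⧸ I) ⧸ J ≅ R ⧸ 𝔞` and `(L ⧸ K_L) ⧸ J' ≅ L ⧸ (K_L + 𝔞 L)`
  have hJ' : J.map (algebraMap (R ⧸ I) (L ⧸ KL)) = (𝔞.map φL).map (Ideal.Quotient.mk KL) := by
    rw [hJ, Ideal.map_map, Ideal.map_map, RingHom.algebraMap_toAlgebra, hθ, Ideal.quotientMap_comp_mk]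
  let e₁ : (R ⧸ I) ⧸ J ≃+* R ⧸ 𝔞 := DoubleQuot.quotQuotEquivQuotOfLE h𝔞
  let e₂ : (L ⧸ KL) ⧸ J.map (algebraMap (R ⧸ I) (L ⧸ KL)) ≃+* L ⧸ (KL ⊔ 𝔞.map φL) :=
    (Ideal.quotEquivOfEq hJ').trans (DoubleQuot.quotQuotEquivQuotSup _ _)
  have hcomp : Ideal.quotientMap (KL ⊔ 𝔞.map φL) φL (le_comap_sup_map c i ψ L 𝔞) =
      (e₂.toRingHom.comp (algebraMap ((R ⧸ I) ⧸ J) ((L ⧸ KL) ⧸ J.map (algebraMap (R ⧸ I) (L ⧸ KL))))).comp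
        e₁.symm.toRingHom := by
    refine RingHom.ext fun r => ?_
    obtain ⟨r, rfl⟩ := Ideal.Quotient.mk_surjective r
    have he₁ : e₁.symm (Ideal.Quotient.mk 𝔞 r) = Ideal.Quotient.mk _ (Ideal.Quotient.mk I r) := by
      rw [RingEquiv.symm_apply_eq]
      rfl
    have hθr : algebraMap (R ⧸ I) (L ⧸ KL) (Ideal.Quotient.mk I r) = Ideal.Quotient.mk KL (φL r) := by
      rw [RingHom.algebraMap_toAlgebra, hθ, Ideal.quotientMap_mk]
    simp only [RingHom.comp_apply, RingEquiv.toRingHom_eq_coe, RingHom.coe_coe, Ideal.quotientMap_mk, he₁,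
      Ideal.Quotient.algebraMap_quotient_map_quotient, hθr]
    rfl
  rw [hcomp]
  exact ((RingHom.Flat.of_bijective (f := e₁.symm.toRingHom) e₁.symm.bijective).comp hflat1).comp
    (RingHom.Flat.of_bijective (f := e₂.toRingHom) e₂.bijective)

include hεC 𝔓 in
/-- **Nonzerodivisors ascend.** For `𝔞 ⊇ I` and `r ∈ R` a nonzerodivisor modulo `𝔞`: `φ_L r = ψ r / 1` is a nonzerodivisor modulo `K_L + 𝔞 L`
(flatness of `θ_𝔞`). [cite: Matsumura1987, Thm. 7.5] -/
theorem mem_sup_of_mul_mem_sup (𝔞 : Ideal R) (h𝔞 : I ≤ 𝔞) (r : R) (hr : ∀ a : R, r * a ∈ 𝔞 → a ∈ 𝔞)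
    (z : L) (hz : φL r * z ∈ KL ⊔ 𝔞.map φL) : z ∈ KL ⊔ 𝔞.map φL := by
  set θ := Ideal.quotientMap (KL ⊔ 𝔞.map φL) φL (le_comap_sup_map c i ψ L 𝔞) with hθ
  letI alg : Algebra (R ⧸ 𝔞) (L ⧸ (KL ⊔ 𝔞.map φL)) := θ.toAlgebra
  haveI : Module.Flat (R ⧸ 𝔞) (L ⧸ (KL ⊔ 𝔞.map φL)) := flat_quotientMap_of_le c i ψ ε hεC 𝔓 L 𝔞 h𝔞
  have hr0 : Ideal.Quotient.mk 𝔞 r ∈ nonZeroDivisors (R ⧸ 𝔞) := by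
    refine mem_nonZeroDivisors_iff_right.mpr fun y hy => ?_
    obtain ⟨a, rfl⟩ := Ideal.Quotient.mk_surjective y
    rw [← map_mul, Ideal.Quotient.eq_zero_iff_mem, mul_comm] at hy
    exact Ideal.Quotient.eq_zero_iff_mem.mpr (hr a hy)
  have hsm := Module.Flat.isSMulRegular_of_nonZeroDivisors (M := L ⧸ (KL ⊔ 𝔞.map φL)) hr0
  have h0 : Ideal.Quotient.mk 𝔞 r • Ideal.Quotient.mk (KL ⊔ 𝔞.map φL) z = 0 := by
    rw [Algebra.smul_def, RingHom.algebraMap_toAlgebra, hθ, Ideal.quotientMap_mk, ← map_mul, Ideal.Quotient.eq_zero_iff_mem]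
    exact hz
  have h1 : Ideal.Quotient.mk (KL ⊔ 𝔞.map φL) z = 0 :=
    hsm (show Ideal.Quotient.mk 𝔞 r • Ideal.Quotient.mk (KL ⊔ 𝔞.map φL) z =
      Ideal.Quotient.mk 𝔞 r • (0 : L ⧸ (KL ⊔ 𝔞.map φL)) by rw [h0, smul_zero])
  exact Ideal.Quotient.eq_zero_iff_mem.mp h1

include hεC in
/-- **`θ_𝔞` is faithfully flat, hence injective, when `𝔓` lies over the maximal ideal of the local ring `R`** (`𝔞 ⊇ I` proper):
`φ_L r ∈ K_L + 𝔞 L ⟹ r ∈ 𝔞`. [cite: Matsumura1987, Thm. 7.5] -/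
theorem mem_of_map_mem_sup [IsLocalRing R] (h𝔓 : 𝔓.comap ψ = maximalIdeal R) (𝔞 : Ideal R) (h𝔞 : I ≤ 𝔞) (h𝔞top : 𝔞 ≠ ⊤)
    (r : R) (hr : φL r ∈ KL ⊔ 𝔞.map φL) : r ∈ 𝔞 := by
  haveI : IsLocalRing L := IsLocalization.AtPrime.isLocalRing L 𝔓
  set θ := Ideal.quotientMap (KL ⊔ 𝔞.map φL) φL (le_comap_sup_map c i ψ L 𝔞) with hθ
  letI alg : Algebra (R ⧸ 𝔞) (L ⧸ (KL ⊔ 𝔞.map φL)) := θ.toAlgebra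
  haveI : Module.Flat (R ⧸ 𝔞) (L ⧸ (KL ⊔ 𝔞.map φL)) := flat_quotientMap_of_le c i ψ ε hεC 𝔓 L 𝔞 h𝔞
  -- `φ_L` is a local map: `φ_L⁻¹(𝔪_L) = 𝔪_R`
  have hloc : ∀ s : R, φL s ∈ maximalIdeal L ↔ s ∈ maximalIdeal R := fun s => by
    rw [RingHom.comp_apply, IsLocalization.AtPrime.to_map_mem_maximal_iff L 𝔓 (ψ s), ← Ideal.mem_comap, h𝔓]
  -- the target ideal is proper
  have hle : KL ⊔ 𝔞.map φL ≤ maximalIdeal L := by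
    refine sup_le ?_ ?_
    · rw [Ideal.map_le_iff_le_comap, Ideal.span_singleton_le_iff_mem, Ideal.mem_comap]
      have h1 : φL (c i) ∈ maximalIdeal L := (hloc (c i)).mpr
        (le_maximalIdeal h𝔞top (h𝔞 (Ideal.subset_span (Set.mem_range_self i))))
      exact h1
    · rw [Ideal.map_le_iff_le_comap]
      intro s hs
      exact (hloc s).mpr (le_maximalIdeal h𝔞top hs)
  have hne : KL ⊔ 𝔞.map φL ≠ ⊤ := fun h => (maximalIdeal.isMaximal L).ne_top (top_le_iff.mp (h ▸ hle))
  haveI : Nontrivial (L ⧸ (KL ⊔ 𝔞.map φL)) := Ideal.Quotient.nontrivial_iff.mpr hne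
  haveI : Nontrivial (R ⧸ 𝔞) := Ideal.Quotient.nontrivial_iff.mpr h𝔞top
  haveI : IsLocalRing (L ⧸ (KL ⊔ 𝔞.map φL)) := IsLocalRing.of_surjective' (Ideal.Quotient.mk _) Ideal.Quotient.mk_surjective
  haveI : IsLocalRing (R ⧸ 𝔞) := IsLocalRing.of_surjective' (Ideal.Quotient.mk _) Ideal.Quotient.mk_surjective
  haveI : IsLocalHom (algebraMap (R ⧸ 𝔞) (L ⧸ (KL ⊔ 𝔞.map φL))) := by
    refine ⟨fun s hs => ?_⟩
    obtain ⟨s, rfl⟩ := Ideal.Quotient.mk_surjective s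
    rw [RingHom.algebraMap_toAlgebra, hθ, Ideal.quotientMap_mk] at hs
    -- `φ_L s` is a unit of `L` (its class is a unit and the ideal is inside `𝔪_L`), so `s ∉ 𝔪_R`
    have h1 : φL s ∉ maximalIdeal L := by
      intro hmem
      apply (IsLocalRing.mem_maximalIdeal _).mp ?_ hs
      -- the class of an element of `𝔪_L` is a nonunit of the local quotient
      intro hu
      obtain ⟨v, hv⟩ := hu.exists_left_inv
      obtain ⟨v, rfl⟩ := Ideal.Quotient.mk_surjective v
      rw [← map_mul, ← map_one (Ideal.Quotient.mk (KL ⊔ 𝔞.map φL)), Ideal.Quotient.eq] at hv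
      have h2 : v * φL s - 1 ∈ maximalIdeal L := hle hv
      have h3 : v * φL s ∈ maximalIdeal L := Ideal.mul_mem_left _ _ hmem
      have h4 : (1 : L) ∈ maximalIdeal L := by
        have := Ideal.sub_mem _ h3 h2
        rwa [sub_sub_cancel] at this
      exact (maximalIdeal.isMaximal L).ne_top (Ideal.eq_top_of_isUnit_mem _ h4 isUnit_one)
    have h2 : IsUnit s := by
      by_contra hns
      exact h1 ((hloc s).mpr ((IsLocalRing.mem_maximalIdeal _).mpr hns))
    exact h2.map _
  haveI : Module.FaithfullyFlat (R ⧸ 𝔞) (L ⧸ (KL ⊔ 𝔞.map φL)) := Module.FaithfullyFlat.of_flat_of_isLocalHom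
  have hinj := FaithfulSMul.algebraMap_injective (R ⧸ 𝔞) (L ⧸ (KL ⊔ 𝔞.map φL))
  have h0 : algebraMap (R ⧸ 𝔞) (L ⧸ (KL ⊔ 𝔞.map φL)) (Ideal.Quotient.mk 𝔞 r) = 0 := by
    rw [RingHom.algebraMap_toAlgebra, hθ, Ideal.quotientMap_mk, Ideal.Quotient.eq_zero_iff_mem]
    exact hr
  rw [← map_zero (algebraMap (R ⧸ 𝔞) (L ⧸ (KL ⊔ 𝔞.map φL)))] at h0
  exact Ideal.Quotient.eq_zero_iff_mem.mp (hinj h0)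

include hεC in
/-- **Reducedness descends** along `θ_𝔞` (`𝔓` over the maximal ideal of the local ring `R`, `𝔞 ⊇ I` proper): if `L ⧸ (K_L + 𝔞 L)` is reduced,
so is `R ⧸ 𝔞`. [cite: Matsumura1987, Thm. 7.5] -/
theorem isReduced_quotient_of_isReduced [IsLocalRing R] (h𝔓 : 𝔓.comap ψ = maximalIdeal R) (𝔞 : Ideal R) (h𝔞 : I ≤ 𝔞)
    (h𝔞top : 𝔞 ≠ ⊤) [IsReduced (L ⧸ (KL ⊔ 𝔞.map φL))] : IsReduced (R ⧸ 𝔞) := by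
  refine ⟨fun s hs => ?_⟩
  obtain ⟨s, rfl⟩ := Ideal.Quotient.mk_surjective s
  obtain ⟨m, hm⟩ := hs
  rw [← map_pow, Ideal.Quotient.eq_zero_iff_mem] at hm
  have h1 : IsNilpotent (Ideal.Quotient.mk (KL ⊔ 𝔞.map φL) (φL s)) := by
    refine ⟨m, ?_⟩
    rw [← map_pow, ← map_pow, Ideal.Quotient.eq_zero_iff_mem]
    exact Ideal.mem_sup_right (Ideal.mem_map_of_mem _ hm)
  have h2 : Ideal.Quotient.mk (KL ⊔ 𝔞.map φL) (φL s) = 0 := h1.eq_zero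
  rw [Ideal.Quotient.eq_zero_iff_mem] at h2 ⊢
  exact mem_of_map_mem_sup c i ψ ε hεC 𝔓 L h𝔓 𝔞 h𝔞 h𝔞top s h2

include hεC in
/-- **Regularity ascends**: for a proper ideal `𝔞 ⊇ I` of the local ring `R` with `R ⧸ 𝔞` a regular ring, and `𝔓` over the maximal ideal,
`L ⧸ (K_L + 𝔞 L)` is a regular local ring — it is a localisation of `A ⧸ ((ψ cᵢ) + 𝔞 A) ≅ (R ⧸ 𝔞)[T_j : j ≠ i]`.
[cite: Matsumura1987, Thm. 19.5 and 23.7] [cite: StacksProject, Tag 0BIQ] -/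
theorem isRegularLocalRing_quotient_sup_of_isRegularRing [IsLocalRing R] (h𝔓 : 𝔓.comap ψ = maximalIdeal R) (𝔞 : Ideal R)
    (h𝔞 : I ≤ 𝔞) (h𝔞top : 𝔞 ≠ ⊤) [IsRegularRing (R ⧸ 𝔞)] : IsRegularLocalRing (L ⧸ (KL ⊔ 𝔞.map φL)) := by
  classical
  set K₀ : Ideal A := KA ⊔ 𝔞.map ψ with hK₀
  have hK₀𝔓 : K₀ ≤ 𝔓 := by
    have hmem : ∀ s ∈ maximalIdeal R, ψ s ∈ 𝔓 := fun s hs => by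
      rw [← h𝔓] at hs; exact hs
    refine sup_le ?_ ?_
    · rw [Ideal.span_singleton_le_iff_mem]
      exact hmem _ (le_maximalIdeal h𝔞top (h𝔞 (Ideal.subset_span (Set.mem_range_self i))))
    · rw [Ideal.map_le_iff_le_comap]
      exact fun s hs => hmem s (le_maximalIdeal h𝔞top hs)
  have hmap : K₀.map (algebraMap A L) = KL ⊔ 𝔞.map φL := by
    rw [hK₀, Ideal.map_sup, Ideal.map_map]
  -- `A ⧸ K₀ ≅ (R ⧸ 𝔞)[T]` is a regular ring
  set J : Ideal (R ⧸ I) := 𝔞.map (Ideal.Quotient.mk I) with hJ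
  haveI : IsRegularRing ((R ⧸ I) ⧸ J) := IsRegularRing.of_ringEquiv (DoubleQuot.quotQuotEquivQuotOfLE h𝔞).symm
  haveI : IsRegularRing (MvPolynomial {j : Fin n // j ≠ i} ((R ⧸ I) ⧸ J)) := inferInstance
  -- through `ε`: the image of `J·P` is `K₀ / KA`
  have hJε : (K₀.map (Ideal.Quotient.mk KA)) = (Ideal.map (MvPolynomial.C) J : Ideal P).map (ε : P →+* A ⧸ KA) := by
    rw [hK₀, Ideal.map_sup, Ideal.map_quotient_self, bot_sup_eq, hJ, Ideal.map_map, Ideal.map_map, Ideal.map_map]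
    -- both sides are generated by the classes of `ψ s`, `s ∈ 𝔞`
    have hfun : ((ε : P →+* A ⧸ KA).comp (MvPolynomial.C.comp (Ideal.Quotient.mk I))) = (Ideal.Quotient.mk KA).comp ψ :=
      RingHom.ext fun s => by simpa only [RingHom.comp_apply, RingHom.coe_coe] using hεC s
    rw [← RingHom.comp_assoc] at hfun
    rw [hfun]
  have e₁ : MvPolynomial {j : Fin n // j ≠ i} ((R ⧸ I) ⧸ J) ≃+* P ⧸ (Ideal.map MvPolynomial.C J : Ideal P) :=
    (MvPolynomial.quotientEquivQuotientMvPolynomial J).toRingEquiv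
  have e₂ : P ⧸ (Ideal.map MvPolynomial.C J : Ideal P) ≃+* (A ⧸ KA) ⧸ K₀.map (Ideal.Quotient.mk KA) :=
    Ideal.quotientEquiv _ _ ε hJε
  have e₃ : (A ⧸ KA) ⧸ K₀.map (Ideal.Quotient.mk KA) ≃+* A ⧸ K₀ := DoubleQuot.quotQuotEquivQuotOfLE (by rw [hK₀]; exact le_sup_left)
  haveI : IsRegularRing (A ⧸ K₀) :=
    IsRegularRing.of_ringEquiv (R := MvPolynomial {j : Fin n // j ≠ i} ((R ⧸ I) ⧸ J)) (e₁.trans (e₂.trans e₃))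
  rw [← hmap]
  exact isRegularLocalRing_quot_map_of_isRegularRing L 𝔓 K₀ hK₀𝔓

end AbstractChart

end Summit.ResolutionOfSingularities.ResolutionOfSingularities.Cruxes.EquisingularLiftNat.Sections.CechShadow

end
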